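import Literature.Computation.Certificates.LieDerivative
import Mathlib.Analysis.Calculus.Deriv.Pi
import HarnessLib

/-!
# GridStability/Lyapunov/PolyRecast — generic glue from an emitted polynomial certificate on
# `Fin N → ℝ` to the curve-form Lyapunov hypotheses (chain rule via the kernel Lie derivative)

Cell `gridfusion` (LADDER-GRIDFUSION), `plan/PARTITION.md` §0 row `Lyapunov/`; seat gridfusion-lyap-1
(g3); namespace `Summit.Ventures.GridStability.Lyapunov.PolyRecast`. PURPOSE: every «…Roa» companion
of a Bench certificate (this seat's generator `gen5.py`, sos-3's adaptation) proves the chain rule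
`d/dt V(z t) = Vdot(z t)` along a solution of the recast system by a TERM-BY-TERM `HasDerivWithinAt`
combination closed by `ring` — source size and `ring` time grow with the number of monomials of `V`
and `V̇` (fine at 3–7 variables; the n = 10 rows of A24/A25-type rungs have `V` with ≈ 400 and `V̇`
with ≈ 2 000 monomials in 27–31 variables). This file replaces that step ONCE AND FOR ALL by
model-1's kernel Lie derivative (`Literature/Computation/Certificates/LieDerivative.lean`, p463444:
`SOS.Poly.lieDeriv`, `SOS.Poly.hasDerivWithinAt_eval_lieDeriv`), read on the phase space
`Fin N → ℝ` that the Bench/Roa files use: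

* `vars_ofFn_of_lt` / `vars_ofFn_of_le` — `SOS.vars (List.ofFn w)` is the coordinate function of
  `w : Fin N → ℝ` (and `0` beyond `N`);
* `hasDerivWithinAt_eval_lieDeriv_fin` — if `w : ℝ → Fin N → ℝ` has coordinate derivatives
  `(Fp.getD i []).eval` at `w t` within `s` (the Bench field, `Fp.length ≤ N`), then for EVERY
  `V : Poly`, `τ ↦ V.eval (vars (List.ofFn (w τ)))` has derivative `(lieDeriv Fp V).eval (…(w t))`
  within `s` at `t`;
* `eval_eq_of_isZero` — `isZero (add p (neg q)) = true → p.eval x = q.eval x`: the emitted `V̇`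
  polynomial of a certificate is identified with `lieDeriv Fp V` by ONE kernel `decide`, whatever
  the term order / normal form of either side;
* `hasDerivWithinAt_eval_of_isZero` — the two combined: the hypothesis
  `HasDerivWithinAt (V ∘ z) (Vdot (z t)) (Ici t) t` of `Lyapunov.certificate_invariance_*` from the
  solution property and one `decide`.

Pure bookkeeping (MODELLED/CERTIFIED columns untouched): no definition, no named fact, standard
axioms. Not here: the `Poly`-valued model block itself (Bench files), compactness / positivity
(per certificate, `CertificateSoundness` helpers).
-/

noncomputable section

open Set Filter Topology
open Literature.Computation.Certificates Literature.Computation.Certificates.SOS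

namespace Summit.Ventures.GridStability.Lyapunov.PolyRecast

/-- `vars (List.ofFn w) k = w ⟨k, _⟩` for `k < N`: the emitted variable vector IS the phase point.
[folklore] -/
theorem vars_ofFn_of_lt {R : Type*} [Zero R] {N : ℕ} (w : Fin N → R) {k : ℕ} (hk : k < N) :
    vars (List.ofFn w) k = w ⟨k, hk⟩ := by
  unfold vars
  rw [List.getD_eq_getElem?_getD, List.getElem?_ofFn]
  simp [hk]

/-- `vars (List.ofFn w) k = 0` for `N ≤ k`. [folklore] -/
theorem vars_ofFn_of_le {R : Type*} [Zero R] {N : ℕ} (w : Fin N → R) {k : ℕ} (hk : N ≤ k) :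
    vars (List.ofFn w) k = 0 := by
  unfold vars
  rw [List.getD_eq_getElem?_getD, List.getElem?_ofFn]
  simp [not_lt.2 hk]

/-- **Chain rule on `Fin N → ℝ` with the kernel Lie derivative.** Let `Fp : List Poly` with
`Fp.length ≤ N` be the recast field's components and `w : ℝ → Fin N → ℝ` a curve whose
coordinates have derivative `(Fp.getD i []).eval (vars (List.ofFn (w t)))` within `s` at `t`
(= `hasDerivWithinAt_pi` applied to a solution of the Bench field). Then for every `V : Poly`,
`τ ↦ V.eval (vars (List.ofFn (w τ)))` has derivative `(lieDeriv Fp V).eval (vars (List.ofFn (w t)))`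
within `s` at `t`. [cite: RoucheHabetsLaloy1977, Ch. I §3.1 eq. (3.1)] -/
theorem hasDerivWithinAt_eval_lieDeriv_fin {N : ℕ} {Fp : List Poly} (hFN : Fp.length ≤ N)
    (V : Poly) {w : ℝ → Fin N → ℝ} {s : Set ℝ} {t : ℝ}
    (hw : ∀ i : Fin N, HasDerivWithinAt (fun τ => w τ i)
      (Poly.eval (vars (List.ofFn (w t))) (Fp.getD i [])) s t) :
    HasDerivWithinAt (fun τ => Poly.eval (vars (List.ofFn (w τ))) V)
      (Poly.eval (vars (List.ofFn (w t))) (Poly.lieDeriv Fp V)) s t := by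
  refine Poly.hasDerivWithinAt_eval_lieDeriv (z := fun τ => vars (List.ofFn (w τ))) V fun k => ?_
  by_cases hk : k < N
  · have h := hw ⟨k, hk⟩
    simp only [vars_ofFn_of_lt _ hk]
    exact h
  · have hk' : N ≤ k := not_lt.1 hk
    have hF : Fp.getD k [] = [] := List.getD_eq_default _ _ (hFN.trans hk')
    simp only [vars_ofFn_of_le _ hk', hF, Poly.eval_nil]
    exact hasDerivWithinAt_const t s (0 : ℝ)

/-- **Two emitted polynomials with zero difference evaluate equally**: `isZero (add p (neg q))`
(one kernel `decide`, insensitive to term order and normal form) gives `p.eval x = q.eval x`.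
[folklore] -/
theorem eval_eq_of_isZero {R : Type*} [Field R] [CharZero R] (x : ℕ → R) {p q : Poly}
    (h : Poly.isZero (Poly.add p (Poly.neg q)) = true) : Poly.eval x p = Poly.eval x q := by
  have h0 := Poly.eval_eq_zero_of_isZero x h
  rw [Poly.eval_add, Poly.eval_neg] at h0
  exact sub_eq_zero.1 (by rw [sub_eq_add_neg]; exact h0)

/-- **The curve-form Lyapunov hypothesis from a certificate's data, generically.** If the emitted
`V̇` polynomial `Vdot` agrees with `lieDeriv Fp V` (`isZero (add Vdot (neg (lieDeriv Fp V)))`, one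
`decide`) and `w` solves the recast system coordinatewise as in
`hasDerivWithinAt_eval_lieDeriv_fin`, then `τ ↦ V.eval (…(w τ))` has derivative
`Vdot.eval (…(w t))` within `s` at `t` — the hypothesis `hφ` of
`Lyapunov.certificate_invariance_tendsto(_univ)` / `tendsto_infDist_dissipation_zero`.
[cite: RoucheHabetsLaloy1977, Ch. I §3.1 eq. (3.1)] -/
theorem hasDerivWithinAt_eval_of_isZero {N : ℕ} {Fp : List Poly} (hFN : Fp.length ≤ N)
    {V Vdot : Poly} (hVdot : Poly.isZero (Poly.add Vdot (Poly.neg (Poly.lieDeriv Fp V))) = true)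
    {w : ℝ → Fin N → ℝ} {s : Set ℝ} {t : ℝ}
    (hw : ∀ i : Fin N, HasDerivWithinAt (fun τ => w τ i)
      (Poly.eval (vars (List.ofFn (w t))) (Fp.getD i [])) s t) :
    HasDerivWithinAt (fun τ => Poly.eval (vars (List.ofFn (w τ))) V)
      (Poly.eval (vars (List.ofFn (w t))) Vdot) s t := by
  rw [eval_eq_of_isZero (vars (List.ofFn (w t))) hVdot]
  exact hasDerivWithinAt_eval_lieDeriv_fin hFN V hw

/-- **A polynomial first integral, generically**: if `lieDeriv Fp h` is the zero polynomial
(`isZero`, one `decide`), then `τ ↦ h.eval (…(w τ))` has derivative `0` along every coordinatewise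
solution — the hypothesis of `constant_of_has_deriv_right_zero` used to keep a recast solution on
its constraint set `{h = 0}`. [folklore] -/
theorem hasDerivWithinAt_eval_zero_of_isZero {N : ℕ} {Fp : List Poly} (hFN : Fp.length ≤ N)
    {h : Poly} (hh : Poly.isZero (Poly.lieDeriv Fp h) = true)
    {w : ℝ → Fin N → ℝ} {s : Set ℝ} {t : ℝ}
    (hw : ∀ i : Fin N, HasDerivWithinAt (fun τ => w τ i)
      (Poly.eval (vars (List.ofFn (w t))) (Fp.getD i [])) s t) :
    HasDerivWithinAt (fun τ => Poly.eval (vars (List.ofFn (w τ))) h) 0 s t := by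
  have h1 := hasDerivWithinAt_eval_lieDeriv_fin hFN h hw
  rwa [Poly.eval_eq_zero_of_isZero _ hh] at h1

end Summit.Ventures.GridStability.Lyapunov.PolyRecast

end
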